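import Mathlib
import Summits.ValiantsHypothesis.ValiantsHypothesis.Theorems.BarrierLeverPartitionMinorsHitByVPHiddenStatesSplitRule

/-!
# Route BarrierLever — item `PartitionMinorsHitByVP` (stmt-ValiantsHypothesis-19717):
# goodness of a hidden family is inherited from any AFFINE IMAGE of it (the pullback lemma)

Helper file (`--supports stmt-ValiantsHypothesis-19717`; cell valiant-natproofs, rung V4, 𝒟-side of door (c); prover seat
val-np-p3 gen 9). Definition-free; route-independent (imports the split-rule engine only). Closes NO item.

THE LEMMA. Let `e : n → Finset (Fin K)` and `e' : n → Finset (Fin K')` be two hidden families with the same index type, and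
suppose an affine map `z ↦ A₀ + Σ_q z_q • A q` (`ℂ^K → ℂ^{K'}`) sends the indicator vector of `e k` to the indicator vector of
`e' k` for every `k`. Then `SymbGood u e' → SymbGood u e` for EVERY column family `u` (`symbGood_of_affineImage`): a table
for `e'` composed with the affine map is a table for `e` with the SAME additive matrix (`table_pullback`; the pulled-back table is the explicit
`Option.elim` expression in its statement). In the language
of the cell memos: `GOOD(𝒰, ·)` only depends on the affine type of the hidden point configuration and is MONOTONE under
affine degeneration — the freer configuration (fewer affine dependencies) is at least as good. The universality of affinely
independent families (`…HiddenStatesAffine.symbGood_of_linearIndependent`) is the extreme case; the typical use is the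
converse bookkeeping: to certify a family `e` it suffices to certify any family `e'` onto which `e` maps affinely, e.g.
(two-layer ball–colex families) `𝔅(K+1, r) ↠ 𝔅(K, r)` by `e_K ↦ 1_{P}` for the one extra pair `P`, so that inside the
two-layer regime `r ≤ 1 + K + K(K-1)/2` Conjecture Q\*(K) for a family `u` implies Q\*(K+1) for `u` (memo
HOME/val-np-p3/g9, §3; the census of record therefore sits at the two-layer threshold `K₂(r)`).

* `table_pullback` — the additive matrices of `(u, e)` under the pulled-back table and of `(u, e')` under the original
  table coincide.
* `symbGood_of_affineImage` — THE LEMMA.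
* `symbGood_of_newState` — corollary: one new state standing for one member (the two-layer monotonicity step).
* `symbGood_of_reindex_states` — corollary: relabelling hidden states along an injection `Fin K ↪ Fin K'` preserves goodness
  (both directions are affine images of each other; stated in the useful direction).

WHAT THIS IS NOT: no new goodness class by itself; nothing on which ball–colex families map onto which (that bookkeeping is
per use); nothing on CPM, crux 14610 or VP ≠ VNP.
-/

set_option linter.dupNamespace false

namespace Summit.ValiantsHypothesis.ValiantsHypothesis.Theorems.BarrierLever.HiddenStates

open Finset Matrix MvPolynomial

noncomputable section

variable {K K' h : ℕ}

/-- **The additive matrix is preserved under pullback.** If the affine map sends `1_{e k}` to `1_{e' k}` for every `k`, then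
the affine functional of coordinate `a` of the pulled-back table at `e k` equals that of `t'` at `e' k`. -/
theorem pullback_apply {n : Type*} (e : n → Finset (Fin K)) (e' : n → Finset (Fin K'))
    (A₀ : Fin K' → ℂ) (A : Fin K → Fin K' → ℂ)
    (hA : ∀ k q', A₀ q' + ∑ q ∈ e k, A q q' = if q' ∈ e' k then 1 else 0)
    (t' : Option (Fin K') → Fin h → ℂ) (k : n) (a : Fin h) :
    (t' none a + ∑ q', A₀ q' * t' (some q') a) + ∑ q ∈ e k, (∑ q', A q q' * t' (some q') a) =
      t' none a + ∑ q' ∈ e' k, t' (some q') a := by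
  classical
  have hswap : ∑ q ∈ e k, ∑ q', A q q' * t' (some q') a = ∑ q', (∑ q ∈ e k, A q q') * t' (some q') a := by
    rw [Finset.sum_comm]
    refine Finset.sum_congr rfl fun q' _ => ?_
    rw [Finset.sum_mul]
  rw [hswap, add_assoc, ← Finset.sum_add_distrib]
  congr 1
  have hterm : ∀ q', A₀ q' * t' (some q') a + (∑ q ∈ e k, A q q') * t' (some q') a =
      (if q' ∈ e' k then 1 else 0) * t' (some q') a := by
    intro q'
    rw [← add_mul, hA k q']
  simp_rw [hterm]
  rw [← Finset.sum_filter_add_sum_filter_not Finset.univ (fun q' => q' ∈ e' k)]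
  have h1 : ∑ q' ∈ Finset.univ.filter (fun q' => q' ∈ e' k), (if q' ∈ e' k then (1 : ℂ) else 0) * t' (some q') a =
      ∑ q' ∈ e' k, t' (some q') a := by
    have hf : Finset.univ.filter (fun q' => q' ∈ e' k) = e' k := by
      ext q'; simp
    rw [hf]
    exact Finset.sum_congr rfl fun q' hq' => by simp [hq']
  have h2 : ∑ q' ∈ Finset.univ.filter (fun q' => ¬ q' ∈ e' k), (if q' ∈ e' k then (1 : ℂ) else 0) * t' (some q') a = 0 :=
    Finset.sum_eq_zero fun q' hq' => by
      rw [Finset.mem_filter] at hq'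
      simp [hq'.2]
  rw [h1, h2, add_zero]

/-- **The additive matrices coincide** (matrix form of `pullback_apply`). -/
theorem table_pullback {n : Type*} (u : n → Finset (Fin h)) (e : n → Finset (Fin K)) (e' : n → Finset (Fin K'))
    (A₀ : Fin K' → ℂ) (A : Fin K → Fin K' → ℂ)
    (hA : ∀ k q', A₀ q' + ∑ q ∈ e k, A q q' = if q' ∈ e' k then 1 else 0)
    (t' : Option (Fin K') → Fin h → ℂ) :
    (Matrix.of fun i k : n => ∏ a ∈ u i,
        ((t' none a + ∑ q', A₀ q' * t' (some q') a) + ∑ q ∈ e k, (∑ q', A q q' * t' (some q') a))) =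
      Matrix.of fun i k : n => ∏ a ∈ u i, (t' none a + ∑ q' ∈ e' k, t' (some q') a) := by
  refine Matrix.ext fun i k => ?_
  simp only [Matrix.of_apply]
  exact Finset.prod_congr rfl fun a _ => pullback_apply e e' A₀ A hA t' k a

/-- **THE PULLBACK LEMMA: goodness is inherited from any affine image.** If an affine map sends the indicator vector of
`e k` to that of `e' k` for every index `k`, then `SymbGood u e'` implies `SymbGood u e`, for every column family `u`. -/
theorem symbGood_of_affineImage {n : Type*} [Fintype n] [DecidableEq n] (u : n → Finset (Fin h))
    (e : n → Finset (Fin K)) (e' : n → Finset (Fin K')) (A₀ : Fin K' → ℂ) (A : Fin K → Fin K' → ℂ)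
    (hA : ∀ k q', A₀ q' + ∑ q ∈ e k, A q q' = if q' ∈ e' k then 1 else 0)
    (hgood : SymbGood u e') : SymbGood u e := by
  obtain ⟨t', ht'⟩ := exists_table_of_symbGood u e' hgood
  -- the pulled-back table: the affine functionals of `t'` composed with the affine map
  refine symbGood_of_table u e
    (fun o a => Option.elim o (t' none a + ∑ q', A₀ q' * t' (some q') a) fun q => ∑ q', A q q' * t' (some q') a) ?_
  have hmat := table_pullback u e e' A₀ A hA t'
  simp only [Option.elim] at hmat ⊢
  rw [hmat]
  exact ht'

/-- **Relabelling hidden states preserves goodness**: if `e k = (e' k).map ι`… stated in the form used in practice: for an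
injection `ι : Fin K' ↪ Fin K` and families with `e k = (e' k).map ι`, `SymbGood u e' → SymbGood u e` (the affine map is the
coordinate projection `z ↦ (z_{ι q'})_{q'}`). -/
theorem symbGood_of_reindex_states {n : Type*} [Fintype n] [DecidableEq n] (u : n → Finset (Fin h))
    (ι : Fin K' ↪ Fin K) (e' : n → Finset (Fin K')) (e : n → Finset (Fin K))
    (he : ∀ k, e k = (e' k).map ι) (hgood : SymbGood u e') : SymbGood u e := by
  classical
  refine symbGood_of_affineImage u e e' 0 (fun q q' => if q = ι q' then 1 else 0) (fun k q' => ?_) hgood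
  rw [Pi.zero_apply, zero_add, he k, Finset.sum_map]
  by_cases hq' : q' ∈ e' k
  · rw [if_pos hq']
    rw [Finset.sum_eq_single_of_mem q' hq' (fun b _ hb => by
      rw [if_neg]
      exact fun hh => hb (ι.injective hh))]
    simp
  · rw [if_neg hq']
    exact Finset.sum_eq_zero fun b hb => by
      rw [if_neg]
      intro hh
      exact hq' (ι.injective hh ▸ hb)

/-- **One new state standing for one new point.** Let `e'` be a hidden family on `K` states and `e` the family on `K + 1`
states obtained by keeping every member (`e k = (e' k).map castSucc` for `k ≠ k₀`) except that the member `e' k₀ = P` is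
replaced by the NEW singleton `{last K}`. Then `SymbGood u e' → SymbGood u e` (affine map: `z ↦ (z_q + z_K · [q ∈ P])_q`).
This is the step `𝔅(K+1, r) ↠ 𝔅(K, r)` of the two-layer monotonicity of Conjecture Q\* (the extra singleton of the larger
state space stands for the one extra pair of the smaller one). -/
theorem symbGood_of_newState {n : Type*} [Fintype n] [DecidableEq n] (u : n → Finset (Fin h))
    (e' : n → Finset (Fin K)) (e : n → Finset (Fin (K + 1))) (k₀ : n) (P : Finset (Fin K))
    (he₀ : e k₀ = {Fin.last K}) (he'₀ : e' k₀ = P)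
    (hother : ∀ k, k ≠ k₀ → e k = (e' k).map Fin.castSuccEmb) (hgood : SymbGood u e') : SymbGood u e := by
  classical
  refine symbGood_of_affineImage u e e' 0
    (fun q q' => if q = Fin.last K then (if q' ∈ P then 1 else 0) else (if q = Fin.castSucc q' then 1 else 0))
    (fun k q' => ?_) hgood
  rw [Pi.zero_apply, zero_add]
  by_cases hk : k = k₀
  · subst hk
    rw [he₀, Finset.sum_singleton, if_pos rfl, he'₀]
  · rw [hother k hk, Finset.sum_map]
    have hterm : ∀ b : Fin K, (if (Fin.castSuccEmb b : Fin (K + 1)) = Fin.last K then (if q' ∈ P then (1 : ℂ) else 0)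
        else (if (Fin.castSuccEmb b : Fin (K + 1)) = Fin.castSucc q' then 1 else 0)) = if b = q' then 1 else 0 := by
      intro b
      have hne : (Fin.castSuccEmb b : Fin (K + 1)) ≠ Fin.last K := by
        rw [Fin.castSuccEmb_apply]; exact Fin.castSucc_ne_last b
      rw [if_neg hne, Fin.castSuccEmb_apply]
      by_cases hb : b = q'
      · simp [hb]
      · rw [if_neg (fun hh => hb (Fin.castSucc_injective K hh)), if_neg hb]
    simp_rw [hterm]
    by_cases hq' : q' ∈ e' k
    · rw [if_pos hq', Finset.sum_ite_eq' (e' k) q' (fun _ => (1 : ℂ)), if_pos hq']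
    · rw [if_neg hq', Finset.sum_ite_eq' (e' k) q' (fun _ => (1 : ℂ)), if_neg hq']

end

end Summit.ValiantsHypothesis.ValiantsHypothesis.Theorems.BarrierLever.HiddenStates
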